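import Summits.ResolutionOfSingularities.ResolutionOfSingularities.Theorems.FrobeniusClosingPatchingRelPerfectDepthLegalRegularLocus
import Literature.AlgebraicGeometry.Resolution.PermissibleCentres
import Mathlib.Topology.JacobsonSpace
import HarnessLib

/-!
# [OURS · L1 W4.2] K2-sep ROUTE A, brick (δ4, first part): **the stalk of the vanishing ideal of a FINITE set of closed points at one of them
# is the maximal ideal** — the hypothesis `hD : 𝓘(C_n)_{x′_n} = 𝔪_{x′_n}` of the K1-à-la-carte theorem
# `false_of_tower_of_forall_freeRational_local` for the base-changed tower, whose centres `ι_n⁻¹{x_n}` are finite sets of closed points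
# (locality of stalks of vanishing ideals, tree `LegalRestart.stalkIdeal_vanishingIdeal_eq_of_inter_eq`, + `stalkIdeal_vanishingIdeal_singleton`)
# (crux `SigmaMaxModifications` stmt-ResolutionOfSingularities-18506 / conjunct stmt-…-19249; line `w_ladder_rows` v8.5, registered stub
# `stub_isoSepRecurrent`; res-L1-w42-plan-1 WORD 2026-08-27T16:25:47Z; design `L/res-L1-w42-stub-2/k2sep/K2SEP-DESIGN.md` §8 (δ3)/(δ4))

Prover res-L1-w42-stub-2 (gen 5). Helper file `--supports stmt-ResolutionOfSingularities-19249 --as helper`; no definitions, no named fact. OURS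
(cell res-hironaka, slot W4.2); NOT statements of [Hironaka2017] nor of [CossartJannsenSaito2020]. AI-written; AI review is weaker than expert
review.

* `isOpen_compl_diff_singleton_of_finite` — for `Z` finite with closed points, `(Z ∖ {z})ᶜ` is an open neighbourhood of `z` meeting `Z` in `{z}`.
* **`stalkIdeal_vanishingIdeal_eq_maximalIdeal_of_finite`** — `𝓘(Z)_z = 𝔪_z` for `Z` a finite set of closed points and `z ∈ Z`.

[OURS · L1 W4.2; AI-written] [cite: CossartJannsenSaito2020, Def. 6.38]
-/

set_option linter.dupNamespace false

noncomputable section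

open CategoryTheory AlgebraicGeometry TopologicalSpace IsLocalRing
open Literature.AlgebraicGeometry.Resolution Scheme.IdealSheafData
open Summit.ResolutionOfSingularities.ResolutionOfSingularities.Theorems

namespace Summit.ResolutionOfSingularities.ResolutionOfSingularities.Theorems.SigmaMaxModificationsCorridor3.IsoTailsHS

universe u

/-- For a finite set `Z` of closed points and `z ∈ Z`, the complement of `Z ∖ {z}` is an open set containing `z` and meeting `Z` exactly in `{z}`.
[folklore] -/
theorem isOpen_compl_diff_singleton_of_finite {Y : Type*} [TopologicalSpace Y] {Z : Set Y} (hfin : Z.Finite)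
    (hcl : ∀ y ∈ Z, IsClosed ({y} : Set Y)) (z : Y) : IsOpen (Z \ {z})ᶜ := by
  have : IsClosed (Z \ {z}) := by
    have h : Z \ {z} = ⋃ y ∈ (hfin.sdiff (t := {z})).toFinset, {y} := by ext y; simp
    rw [h]
    exact isClosed_biUnion_finset fun y hy => hcl y ((Set.Finite.mem_toFinset _).mp hy).1
  exact this.isOpen_compl

/-- **`𝓘(Z)_z = 𝔪_z` for a FINITE set `Z` of closed points of a scheme and `z ∈ Z`**: near `z` the closed set `Z` is `{z}`, stalks of vanishing
ideals are local (`LegalRestart.stalkIdeal_vanishingIdeal_eq_of_inter_eq`), and `𝓘({z})_z = 𝔪_z` (`stalkIdeal_vanishingIdeal_singleton`). The shape of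
the centres `ι_n⁻¹{x_n}` of a ground-field base change of a point tower. [cite: CossartJannsenSaito2020, Def. 6.38] -/
theorem stalkIdeal_vanishingIdeal_eq_maximalIdeal_of_finite {X : Scheme.{u}} {Z : Set X} (hZ : IsClosed Z) (hfin : Z.Finite)
    (hcl : ∀ y ∈ Z, IsClosed ({y} : Set X)) {z : X} (hz : z ∈ Z) :
    stalkIdeal (vanishingIdeal ⟨Z, hZ⟩) z = maximalIdeal (X.presheaf.stalk z) := by
  have hW := isOpen_compl_diff_singleton_of_finite hfin hcl z
  have hzW : z ∈ (Z \ {z})ᶜ := fun h => h.2 rfl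
  have hinter : (Z : Set X) ∩ (Z \ {z})ᶜ = ({z} : Set X) ∩ (Z \ {z})ᶜ := by
    ext y
    simp only [Set.mem_inter_iff, Set.mem_compl_iff, Set.mem_sdiff, Set.mem_singleton_iff, not_and, not_not]
    constructor
    · rintro ⟨hyZ, h⟩; exact ⟨h hyZ, fun _ => h hyZ⟩
    · rintro ⟨rfl, -⟩; exact ⟨hz, fun _ => rfl⟩
  rw [LegalRestart.stalkIdeal_vanishingIdeal_eq_of_inter_eq (T := ⟨Z, hZ⟩) (T' := ⟨{z}, hcl z hz⟩) hW hzW hinter]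
  exact stalkIdeal_vanishingIdeal_singleton (hcl z hz)

end Summit.ResolutionOfSingularities.ResolutionOfSingularities.Theorems.SigmaMaxModificationsCorridor3.IsoTailsHS

end
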